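import Mathlib
import HarnessLib
import Summits.HubbardSuperconductivity.HubbardSuperconductivity.Theorems.KLProgrammeKLRegimeEnginePairTransferBaseSecondOrderArith

/-!
# Route `KLProgramme` — ENGINE item stmt-HubbardSuperconductivity-20437 `KLRegimeEngineV17F2`, class #5 BASE, located item «SCALE0-MEMBER-DIFF» (pen (R494)(C)(iii)),
# PART 1: THE SCALE-0 MEMBER DIFFERENCE MINUS ITS EXPLICIT SECOND-ORDER TERM IS `O(U³)` — **`klso_memberDiff_sub_second_le_of_gridStep`**
# (cell gate-hubbard-kl, seat hubbard-kl-k3c1-p1 g23, technique «composed-map remainder propagation»; scope memo SCALE0-MEMBER-DIFF-SCOPE.md (L1)+(L2)+(L3)+(L5))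

WHY.  «(X).2′-BASE-ROOM» (✓ p731331): the BASE scalar row of «95v2» carries k3c2-p1 g5's scale-0 transfer constant `klTransferC R ≥ 2¹⁰²` because the member
difference `𝒜₀[S_{ψ₁}] − 𝒜₀[S_{ψ₂}]` is bounded through the WHOLE degree-≥6 tail of the grid action `𝒢₀ = effAction C′ Ṽ` by graded determinant norms
(`klmg_memberAmplitude_sub_le_of_gridStep`: `∝ A·θ`, `A ∝ U`, `θ ∝ U`).  Cure (β) = keep the SECOND-ORDER term explicit and bound only the rest.  This file does the
order split: with `X = −Ṽ`, `T_n := −(n!)⁻¹·𝓔ᵀ_{C′}(X;n)` (`cumulantOf (fun k => evenGaussConv ℂ C′ (X^k)) n`, the Literature's truncated expectations) and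
`R₃ := 𝒢₀ − T₁ − T₂`:
* `R₃`'s pinned kernel norms are `≤ ρ^{−2m′}·A·θ²·θ^{m′−4}` — degrees `≤ 6` from the ORDER-`3` tail
  `Literature…GrassmannEffectiveActionTruncationDB.sum_norm_kernel_effAction_add_sum_cumulant_le_of_gramBounded` (`n₀ = 3`), degrees `≥ 8` from the GRADED bound of `𝒢₀`
  (`…GradedDB.sum_norm_kernel_effAction_le_pow_of_gramBounded_quartic`) since `T₁`, `T₂` have no kernels there (`kernel_cumulantOf_eq_zero_of_degree_lt`);
* `T₁ = e^{Δ_{C′}}Ṽ` has degree `≤ 4`, so its smeared quartic vertex does not depend on the member (binomial–Gram defect with a profile vanishing above degree 4);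
* the member difference of the `R₃`-carrier is a two-level binomial–Gram sum (`klmg_vertexFn_map_gaussConv_sub_le_binomial₂`) resummed by §1's arithmetic:
  **`klso_memberDiff_sub_second_le_of_gridStep`**: `‖(𝒜₀[S_{ψ₁}] − 𝒜₀[S_{ψ₂}]) − (E₂[ψ₁] − E₂[ψ₂])‖ ≤ (96·N/β)·(1792·κD²·(2ρ⁻¹)⁶·A·θ²)` where
  `E₂[ψ] := 𝒱₄(map S (e^{Δ_{SᵀS_ψS}} T₂))(pairLegs Q k k′)` is the EXPLICIT SECOND-ORDER member term — one more factor `θ ∝ U` than the old bound: `O(U³)`.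
The explicit term's own bound (`≤ X₂·klIdxMass 0 j′·U²`, the one-loop bubble with a `D`-line, scope (L4)) and the BASE re-key (L6) are NOT in this file.
Pure composition of landed Literature/tree theorems + real arithmetic; nothing about the model's sizes is asserted; nothing asserts (X), any stub, K3 or superconductivity.
0 kit · 0 lit.  References: BGM 2006 (2.13)–(2.14), (2.77)–(2.80) [cite: BenfattoGiulianiMastropietro2006].
-/

noncomputable section

namespace Summit.HubbardSuperconductivity.HubbardSuperconductivity.Theorems.KLRegimeSplit

set_option linter.dupNamespace false -- summit = problem name (single-conjunct summit), D-0017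

open Real Finset Matrix Set Literature.MathematicalPhysics.QuantumLattice Literature.Probability.LatticeModels GrassmannAlgebra
open Summit.HubbardSuperconductivity.HubbardSuperconductivity.Theorems.KLProgrammeLegKernels
open Summit.HubbardSuperconductivity.HubbardSuperconductivity.Theorems.DispersionFlow
open Summit.HubbardSuperconductivity.HubbardSuperconductivity.Theorems.KLRegimeWick
open Summit.HubbardSuperconductivity.HubbardSuperconductivity.Theorems.EngineV8
open Summit.HubbardSuperconductivity.HubbardSuperconductivity.Theorems.ScaleZeroDecay

/-! ## §3 The order split at scale `0`: the member difference minus its explicit second-order term -/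

section Step

variable {L M : ℕ} [NeZero L]

set_option maxHeartbeats 1600000 in -- long step data; three kernel-norm regimes
/-- **`klso_memberDiff_sub_second_le_of_gridStep`** — for the scale-0 grid step data of `norm_klCovSmearedPairAmplitude_zero_sub_le_of_gridStep` (Gram `κ` and
row/column sums `α` of `C′ = SᵀC^K_{>e₀}S`, weight `ρ`, degree-2 size `N₁`, `θ = eα‖Ṽ‖_h/κ² < 1`, here also `θ ≤ 1`), two members `ψ₁ ψ₂` with Gram constants `γ`
(member 2) and `κD` (`D`-line), `4γ²θρ⁻² ≤ 1/2`, `4κD²θ(2ρ⁻¹)² ≤ 1/2`, `4γ²ρ⁻² ≤ 2`, `4κD²(2ρ⁻¹)² ≤ 1`, and the EXPLICIT SECOND-ORDER grid term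
`T₂ = −(2!)⁻¹·𝓔ᵀ_{C′}(−Ṽ; 2)`:
`‖(𝒜₀[S_{ψ₁}] − 𝒜₀[S_{ψ₂}]) − (E₂[ψ₁] − E₂[ψ₂])‖ ≤ (96·N/β)·(1792·κD²·(2ρ⁻¹)⁶·(A·θ²))`, `E₂[ψ] = 𝒱₄(map S (e^{Δ_{SᵀS_ψS}}T₂))(pairLegs Q k k′)`, `A = e‖Ṽ‖_h/(1−θ)`. -/
theorem klso_memberDiff_sub_second_le_of_gridStep [NeZero M] {β : ℝ} (hβ : 0 < β) (U μ : ℝ) (K : TrigPolyC4v)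
    {κ : ℝ} (hκ : 0 < κ)
    (hGB : IsGramBoundedR ((hubbardGridSub L M β (2 * (2 * M))).transpose * hubbardCovAboveCT L M β μ 0 K klE0 *
      hubbardGridSub L M β (2 * (2 * M))) κ)
    {α : ℝ} (hα : 0 < α)
    (hrow : ∀ X, ∑ Y, ‖((hubbardGridSub L M β (2 * (2 * M))).transpose * hubbardCovAboveCT L M β μ 0 K klE0 *
      hubbardGridSub L M β (2 * (2 * M))) X Y‖ ≤ α)
    (hcol : ∀ Y, ∑ X, ‖((hubbardGridSub L M β (2 * (2 * M))).transpose * hubbardCovAboveCT L M β μ 0 K klE0 *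
      hubbardGridSub L M β (2 * (2 * M))) X Y‖ ≤ α)
    {ρ : ℝ} (hρ : 0 < ρ) {N₁ : ℝ} (hN₁ : 0 ≤ N₁)
    (hct : ∀ (j : Fin 2) (w : GridLeg (GridPoint L (2 * (2 * M)))),
      ∑ Y ∈ univ.filter (fun Y : Fin 2 → GridLeg (GridPoint L (2 * (2 * M))) => Y j = w),
        ‖kernel ℂ (hubbardGridCounterQuadratic L (2 * (2 * M)) β K) 2 Y‖ ≤ N₁)
    (hθ : Real.exp 1 * α * normV (GridLeg (GridPoint L (2 * (2 * M)))) κ ρ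
      (fun m' : ℕ => if m' = 1 then N₁ else if m' = 2 then |U| * |β| / (2 * (2 * M) : ℕ) else 0) / κ ^ 2 < 1)
    (ψ₁ ψ₂ : FreqMomentum L M → ℝ)
    {γ : ℝ} (hγ : 0 ≤ γ) (hGγ : IsGramBoundedR ((hubbardGridSub L M β (2 * (2 * M))).transpose * softCovOf L M β μ K ψ₂ * hubbardGridSub L M β (2 * (2 * M))) γ)
    {κD : ℝ} (hκD : 0 ≤ κD) (hGD : IsGramBoundedR ((hubbardGridSub L M β (2 * (2 * M))).transpose * softCovOf L M β μ K (ψ₁ - ψ₂) * hubbardGridSub L M β (2 * (2 * M))) κD)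
    (hy : 4 * (γ ^ 2 * (Real.exp 1 * α * normV (GridLeg (GridPoint L (2 * (2 * M)))) κ ρ
      (fun m' : ℕ => if m' = 1 then N₁ else if m' = 2 then |U| * |β| / (2 * (2 * M) : ℕ) else 0) / κ ^ 2) * ρ⁻¹ ^ 2) ≤ 1 / 2)
    (hyD : 4 * (κD ^ 2 * (Real.exp 1 * α * normV (GridLeg (GridPoint L (2 * (2 * M)))) κ ρ
      (fun m' : ℕ => if m' = 1 then N₁ else if m' = 2 then |U| * |β| / (2 * (2 * M) : ℕ) else 0) / κ ^ 2) * (2 * ρ⁻¹) ^ 2) ≤ 1 / 2)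
    (hg : 4 * (γ ^ 2 * ρ⁻¹ ^ 2) ≤ 2) (hu : 4 * (κD ^ 2 * (2 * ρ⁻¹) ^ 2) ≤ 1)
    (T₂ : GrassmannAlgebra ℂ (GridLeg (GridPoint L (2 * (2 * M)))))
    (hT₂ : T₂ = -((((2 : ℕ).factorial : ℕ) : ℂ)⁻¹ •
      ((cumulantOf (fun k => evenGaussConv ℂ ((hubbardGridSub L M β (2 * (2 * M))).transpose * hubbardCovAboveCT L M β μ 0 K klE0 * hubbardGridSub L M β (2 * (2 * M)))
        ((⟨-(hubbardGridInteraction L (2 * (2 * M)) β U + hubbardGridCounterQuadratic L (2 * (2 * M)) β K),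
          neg_mem (add_mem (hubbardGridInteraction_mem_evenPart β U) (hubbardGridCounterQuadratic_mem_evenPart β K))⟩ :
            evenPart ℂ (GridLeg (GridPoint L (2 * (2 * M))))) ^ k)) 2 : evenPart ℂ (GridLeg (GridPoint L (2 * (2 * M))))) :
              GrassmannAlgebra ℂ (GridLeg (GridPoint L (2 * (2 * M)))))))
    (Qm k k' : TorusSite 2 L) :
    ‖(klCovSmearedPairAmplitude L M β U μ K 0 (softCovOf L M β μ K ψ₁) Qm k k' - klCovSmearedPairAmplitude L M β U μ K 0 (softCovOf L M β μ K ψ₂) Qm k k') -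
        (vertexFn L M β (ExteriorAlgebra.map (Matrix.toLin' (hubbardGridSub L M β (2 * (2 * M))))
            (gaussConv ℂ ((hubbardGridSub L M β (2 * (2 * M))).transpose * softCovOf L M β μ K ψ₁ * hubbardGridSub L M β (2 * (2 * M))) T₂)) 4 (pairLegs L M Qm k k') -
          vertexFn L M β (ExteriorAlgebra.map (Matrix.toLin' (hubbardGridSub L M β (2 * (2 * M))))
            (gaussConv ℂ ((hubbardGridSub L M β (2 * (2 * M))).transpose * softCovOf L M β μ K ψ₂ * hubbardGridSub L M β (2 * (2 * M))) T₂)) 4 (pairLegs L M Qm k k'))‖ ≤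
      96 * ((2 * (2 * M) : ℕ) : ℝ) / β *
        (1792 * κD ^ 2 * (2 * ρ⁻¹) ^ 6 *
          (Real.exp 1 * normV (GridLeg (GridPoint L (2 * (2 * M)))) κ ρ (fun m' : ℕ => if m' = 1 then N₁ else if m' = 2 then |U| * |β| / (2 * (2 * M) : ℕ) else 0) /
              (1 - Real.exp 1 * α * normV (GridLeg (GridPoint L (2 * (2 * M)))) κ ρ
                (fun m' : ℕ => if m' = 1 then N₁ else if m' = 2 then |U| * |β| / (2 * (2 * M) : ℕ) else 0) / κ ^ 2) *
            (Real.exp 1 * α * normV (GridLeg (GridPoint L (2 * (2 * M)))) κ ρ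
              (fun m' : ℕ => if m' = 1 then N₁ else if m' = 2 then |U| * |β| / (2 * (2 * M) : ℕ) else 0) / κ ^ 2) ^ 2)) := by
  -- notation (as in `klmg_memberAmplitude_sub_le_of_gridStep`)
  haveI : NeZero (2 * (2 * M)) := ⟨by have := NeZero.ne M; omega⟩
  set S := hubbardGridSub L M β (2 * (2 * M)) with hS
  set C' := S.transpose * hubbardCovAboveCT L M β μ 0 K klE0 * S with hC'
  set Vt := hubbardGridInteraction L (2 * (2 * M)) β U + hubbardGridCounterQuadratic L (2 * (2 * M)) β K with hVt
  set prof : ℕ → ℝ := fun m' : ℕ => if m' = 1 then N₁ else if m' = 2 then |U| * |β| / (2 * (2 * M) : ℕ) else 0 with hprof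
  set nV : ℝ := normV (GridLeg (GridPoint L (2 * (2 * M)))) κ ρ prof with hnV
  set θ : ℝ := Real.exp 1 * α * nV / κ ^ 2 with hθdef
  set A : ℝ := Real.exp 1 * nV / (1 - θ) with hA
  have hL : (0 : ℝ) < L := by exact_mod_cast Nat.pos_of_ne_zero (NeZero.ne L)
  have hnV0 : 0 ≤ nV := by rw [hnV]; exact normV_nonneg hκ.le hρ.le (klsv_profile_nonneg β U (2 * (2 * M)) hN₁)
  have hθ0 : 0 ≤ θ := by positivity
  have hθ1 : θ < 1 := hθ
  have hA0 : 0 ≤ A := div_nonneg (by positivity) (by linarith)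
  -- the grid action and its even/constant facts
  set F := effAction ℂ C' Vt with hF
  have hVt_even : Vt ∈ evenPart ℂ (GridLeg (GridPoint L (2 * (2 * M)))) :=
    add_mem (hubbardGridInteraction_mem_evenPart β U) (hubbardGridCounterQuadratic_mem_evenPart β K)
  have hVt0 : constPart ℂ Vt = 0 := by
    rw [hVt, map_add, constPart_hubbardGridInteraction, constPart_hubbardGridCounterQuadratic, add_zero]
  have hF_even : F ∈ evenPart ℂ (GridLeg (GridPoint L (2 * (2 * M)))) := effAction_mem_evenPart C' hVt_even hVt0
  have hdeg : ∀ m'', 2 < m'' → ∀ Y : Fin (2 * m'') → GridLeg (GridPoint L (2 * (2 * M))), kernel ℂ Vt (2 * m'') Y = 0 := fun m'' hm'' Y => by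
    rw [hVt, kernel_add, kernel_hubbardGridInteraction_of_ne β U (by omega) Y, kernel_hubbardGridCounterQuadratic_of_ne β K (by omega) Y, add_zero]
  have hprofV : ∀ m' (j : Fin (2 * m')) (w : GridLeg (GridPoint L (2 * (2 * M)))),
      ∑ Y ∈ univ.filter (fun Y : Fin (2 * m') → GridLeg (GridPoint L (2 * (2 * M))) => Y j = w), ‖kernel ℂ Vt (2 * m') Y‖ ≤ prof m' :=
    klsv_sum_norm_kernel_gridVertex_le β U K hN₁ hct
  -- the truncated expectations
  set Xv : evenPart ℂ (GridLeg (GridPoint L (2 * (2 * M)))) := ⟨-Vt, neg_mem hVt_even⟩ with hXv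
  set cum : ℕ → evenPart ℂ (GridLeg (GridPoint L (2 * (2 * M)))) := fun n => cumulantOf (fun k => evenGaussConv ℂ C' (Xv ^ k)) n with hcum
  have hT₂' : T₂ = -((((2 : ℕ).factorial : ℕ) : ℂ)⁻¹ • ((cum 2 : evenPart ℂ _) : GrassmannAlgebra ℂ (GridLeg (GridPoint L (2 * (2 * M)))))) := hT₂
  -- R' := F + (2!)⁻¹·cum₂, so that F = R' + T₂
  set R' : GrassmannAlgebra ℂ (GridLeg (GridPoint L (2 * (2 * M)))) := F + (((2 : ℕ).factorial : ℕ) : ℂ)⁻¹ • ((cum 2 : evenPart ℂ _) : GrassmannAlgebra ℂ _) with hR'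
  have hFR : F = R' + T₂ := by rw [hR', hT₂']; abel
  have hR'_even : R' ∈ evenPart ℂ (GridLeg (GridPoint L (2 * (2 * M)))) := add_mem hF_even (Submodule.smul_mem _ _ (cum 2).2)
  -- (1) kernel facts of the cumulants: `cum 1` has no degree > 4, `cum 2` none > 6
  have hcum1_zero : ∀ m', 2 < m' → ∀ Y : Fin (2 * m') → GridLeg (GridPoint L (2 * (2 * M))), kernel ℂ ((cum 1 : evenPart ℂ _) : GrassmannAlgebra ℂ _) (2 * m') Y = 0 :=
    fun m' hm' Y => kernel_cumulantOf_eq_zero_of_degree_lt C' hκ.le hGB Vt hVt_even (d := 2) hdeg (n := 1) one_pos (r := 2 * m') (by omega) Y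
  have hcum2_zero : ∀ m', 3 < m' → ∀ Y : Fin (2 * m') → GridLeg (GridPoint L (2 * (2 * M))), kernel ℂ ((cum 2 : evenPart ℂ _) : GrassmannAlgebra ℂ _) (2 * m') Y = 0 :=
    fun m' hm' Y => kernel_cumulantOf_eq_zero_of_degree_lt C' hκ.le hGB Vt hVt_even (d := 2) hdeg (n := 2) two_pos (r := 2 * m') (by omega) Y
  -- pinned norms of `cum 1 = e^{Δ_{C′}}(−Ṽ)`: the binomial profile of `prof` (zero above degree 4)
  set NT : ℕ → ℝ := fun m' => ∑ m'' ∈ range (Fintype.card (GridLeg (GridPoint L (2 * (2 * M)))) / 2 + 1),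
    if m' ≤ m'' then ((2 * m'').choose (2 * m') : ℝ) * κ ^ (2 * m'' - 2 * m') * prof m'' else 0 with hNTdef
  have hNT0 : ∀ m', 0 ≤ NT m' := fun m' => klmd_binomialProfile_nonneg hκ.le prof (klsv_profile_nonneg β U (2 * (2 * M)) hN₁) _ m'
  have hcum1_eq : ((cum 1 : evenPart ℂ _) : GrassmannAlgebra ℂ _) = gaussConv ℂ C' (-Vt) := by
    rw [hcum]; dsimp only; rw [cumulantOf_one, pow_one]; rfl
  have hNT : ∀ m' (j : Fin (2 * m')) (w : GridLeg (GridPoint L (2 * (2 * M)))),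
      ∑ Y ∈ univ.filter (fun Y : Fin (2 * m') → GridLeg (GridPoint L (2 * (2 * M))) => Y j = w), ‖kernel ℂ ((cum 1 : evenPart ℂ _) : GrassmannAlgebra ℂ _) (2 * m') Y‖ ≤ NT m' := by
    intro m' j w
    rw [hcum1_eq]
    have hprofneg : ∀ m' (j : Fin (2 * m')) (w : GridLeg (GridPoint L (2 * (2 * M)))),
        ∑ Y ∈ univ.filter (fun Y : Fin (2 * m') → GridLeg (GridPoint L (2 * (2 * M))) => Y j = w), ‖kernel ℂ (-Vt) (2 * m') Y‖ ≤ prof m' := by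
      intro m' j w
      refine le_of_eq_of_le (sum_congr rfl fun Y _ => ?_) (hprofV m' j w)
      rw [← neg_one_smul ℂ Vt, kernel_smul, norm_mul, norm_neg, norm_one, one_mul]
    exact klmg_sum_norm_kernel_gaussConv_le_binomial hκ.le hGB (-Vt) (neg_mem hVt_even) prof (klsv_profile_nonneg β U (2 * (2 * M)) hN₁) hprofneg m' j w
  have hNT_zero : ∀ m', 2 < m' → NT m' = 0 := by
    intro m' hm'
    rw [hNTdef]
    refine sum_eq_zero fun m'' _ => ?_
    split_ifs with h
    · rw [hprof]; dsimp only; rw [if_neg (by omega), if_neg (by omega)]; ring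
    · rfl
  -- (2) pinned norms of `R'`: `NR' m′ := ρ⁻¹^{2m′}·A·θ²·θ^{m′−4} + NT m′`
  set NR : ℕ → ℝ := fun m' => ρ⁻¹ ^ (2 * m') * A * θ ^ 2 * θ ^ (m' - 4) + NT m' with hNR
  have hNR0 : ∀ m', 0 ≤ NR m' := fun m' => by have := hNT0 m'; positivity
  have hNR' : ∀ (m' : ℕ) (j : Fin (2 * m')) (w : GridLeg (GridPoint L (2 * (2 * M)))),
      ∑ Y ∈ univ.filter (fun Y : Fin (2 * m') → GridLeg (GridPoint L (2 * (2 * M))) => Y j = w), ‖kernel ℂ R' (2 * m') Y‖ ≤ NR m' := by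
    intro m' j w
    rcases Nat.lt_or_ge m' 4 with hm | hm
    · -- degrees ≤ 6: the order-3 tail + the first cumulant
      rcases Nat.eq_zero_or_pos m' with rfl | hm0
      · exact absurd j.2 (by omega)
      · have htail := (sum_norm_kernel_effAction_add_sum_cumulant_le_of_gramBounded C' hκ hGB Vt hVt_even hVt0 prof (klsv_profile_nonneg β U (2 * (2 * M)) hN₁)
          hprofV hα hrow hcol hρ hθ (n₀ := 3) (by norm_num)).2 (m := 2 * m') (by omega) j w
        -- `kernel R' = (kernel F + Σ_{n=1,2} (n!)⁻¹ kernel cum_n) − kernel cum₁`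
        have hsplit : ∀ Y : Fin (2 * m') → GridLeg (GridPoint L (2 * (2 * M))),
            kernel ℂ R' (2 * m') Y = (kernel ℂ F (2 * m') Y + ∑ n ∈ Ico 1 3, (((n.factorial : ℕ) : ℂ))⁻¹ *
              kernel ℂ ((cum n : evenPart ℂ _) : GrassmannAlgebra ℂ _) (2 * m') Y) - kernel ℂ ((cum 1 : evenPart ℂ _) : GrassmannAlgebra ℂ _) (2 * m') Y := by
          intro Y
          have hIco : Finset.Ico 1 3 = {1, 2} := by decide
          rw [hIco, sum_pair (by norm_num), hR', kernel_add, kernel_smul]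
          simp only [Nat.factorial_one, Nat.factorial_two, Nat.cast_one, inv_one, one_mul]
          ring
        calc ∑ Y ∈ univ.filter (fun Y : Fin (2 * m') → GridLeg (GridPoint L (2 * (2 * M))) => Y j = w), ‖kernel ℂ R' (2 * m') Y‖
            ≤ ∑ Y ∈ univ.filter (fun Y : Fin (2 * m') → GridLeg (GridPoint L (2 * (2 * M))) => Y j = w),
                (‖kernel ℂ F (2 * m') Y + ∑ n ∈ Ico 1 3, (((n.factorial : ℕ) : ℂ))⁻¹ * kernel ℂ ((cum n : evenPart ℂ _) : GrassmannAlgebra ℂ _) (2 * m') Y‖ +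
                  ‖kernel ℂ ((cum 1 : evenPart ℂ _) : GrassmannAlgebra ℂ _) (2 * m') Y‖) := sum_le_sum fun Y _ => by rw [hsplit Y]; exact norm_sub_le _ _
          _ ≤ ρ⁻¹ ^ (2 * m') * (Real.exp 1 * nV) * θ ^ (3 - 1) / (1 - θ) + NT m' := by
              rw [sum_add_distrib]; exact add_le_add htail (hNT m' j w)
          _ = NR m' := by
              rw [hNR, hA]; dsimp only
              rw [show m' - 4 = 0 by omega, pow_zero, mul_one, show (3 : ℕ) - 1 = 2 by norm_num]
              ring
    · -- degrees ≥ 8: `kernel R' = kernel F` (the second cumulant has no such kernels), graded bound of `F`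
      have heq : ∀ Y : Fin (2 * m') → GridLeg (GridPoint L (2 * (2 * M))), kernel ℂ R' (2 * m') Y = kernel ℂ F (2 * m') Y := by
        intro Y; rw [hR', kernel_add, kernel_smul, hcum2_zero m' (by omega) Y, mul_zero, add_zero]
      have hgr := (sum_norm_kernel_effAction_le_pow_of_gramBounded_quartic C' hκ hGB Vt hVt_even hVt0 prof (klsv_profile_nonneg β U (2 * (2 * M)) hN₁)
        hprofV hdeg hα hrow hcol hρ hθ (p := m') (by omega) j w).2
      calc ∑ Y ∈ univ.filter (fun Y : Fin (2 * m') → GridLeg (GridPoint L (2 * (2 * M))) => Y j = w), ‖kernel ℂ R' (2 * m') Y‖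
          = ∑ Y ∈ univ.filter (fun Y : Fin (2 * m') → GridLeg (GridPoint L (2 * (2 * M))) => Y j = w), ‖kernel ℂ F (2 * m') Y‖ := sum_congr rfl fun Y _ => by rw [heq Y]
        _ ≤ ρ⁻¹ ^ (2 * m') * (Real.exp 1 * nV) * θ ^ (m' - 2) / (1 - θ) := hgr
        _ = ρ⁻¹ ^ (2 * m') * A * θ ^ 2 * θ ^ (m' - 4) := by
            rw [hA, show m' - 2 = 2 + (m' - 4) by omega, pow_add]; ring
        _ ≤ NR m' := by rw [hNR]; dsimp only; linarith [hNT0 m']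
  -- (3) the smeared amplitudes through `F = R' + T₂`
  have hsc : klScale klE0 0 = klE0 := by simp [klScale]
  have hV0 : klEffectiveAction L M β U μ K klE0 0 = hubbardEffectiveActionCT L M β U μ 0 K (klScale klE0 0) := rfl
  have hamp : ∀ ψ : FreqMomentum L M → ℝ, klCovSmearedPairAmplitude L M β U μ K 0 (softCovOf L M β μ K ψ) Qm k k' =
      vertexFn L M β (ExteriorAlgebra.map (Matrix.toLin' S) (gaussConv ℂ (S.transpose * softCovOf L M β μ K ψ * S) R')) 4 (pairLegs L M Qm k k') +
        vertexFn L M β (ExteriorAlgebra.map (Matrix.toLin' S) (gaussConv ℂ (S.transpose * softCovOf L M β μ K ψ * S) T₂)) 4 (pairLegs L M Qm k k') := by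
    intro ψ
    rw [klCovSmearedPairAmplitude, hV0, hsc, klmg_carrier_eq_map_grid L M β U μ K hβ.ne' (softCovOf L M β μ K ψ) klE0, ← vertexFn_add, ← map_add, ← map_add,
      ← hFR]
    rfl
  have hkey : (klCovSmearedPairAmplitude L M β U μ K 0 (softCovOf L M β μ K ψ₁) Qm k k' - klCovSmearedPairAmplitude L M β U μ K 0 (softCovOf L M β μ K ψ₂) Qm k k') -
        (vertexFn L M β (ExteriorAlgebra.map (Matrix.toLin' S) (gaussConv ℂ (S.transpose * softCovOf L M β μ K ψ₁ * S) T₂)) 4 (pairLegs L M Qm k k') -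
          vertexFn L M β (ExteriorAlgebra.map (Matrix.toLin' S) (gaussConv ℂ (S.transpose * softCovOf L M β μ K ψ₂ * S) T₂)) 4 (pairLegs L M Qm k k')) =
      vertexFn L M β (ExteriorAlgebra.map (Matrix.toLin' S) (gaussConv ℂ (S.transpose * softCovOf L M β μ K ψ₁ * S) R')) 4 (pairLegs L M Qm k k') -
        vertexFn L M β (ExteriorAlgebra.map (Matrix.toLin' S) (gaussConv ℂ (S.transpose * softCovOf L M β μ K ψ₂ * S) R')) 4 (pairLegs L M Qm k k') := by
    rw [hamp ψ₁, hamp ψ₂]; ring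
  rw [hkey]
  -- (4) the member difference of the `R'`-carrier and the resummation
  have hmain := klso_vertexDiff_le (L := L) (M := M) hβ μ K ψ₁ ψ₂ hκD hGD hγ hGγ R' hR'_even NR hNR0 hNR' (pairLegs L M Qm k k')
  refine hmain.trans ?_
  -- inner sums: only `m″ ≥ m′ ≥ 3` occur, where `NT m″ = 0`
  have hinner : ∀ m' : ℕ, 2 < m' →
      ∑ m'' ∈ range (Fintype.card (GridLeg (GridPoint L (2 * (2 * M)))) / 2 + 1), (if m' ≤ m'' then ((2 * m'').choose (2 * m') : ℝ) * γ ^ (2 * m'' - 2 * m') * NR m'' else 0) ≤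
        7 * ((2 * ρ⁻¹) ^ (2 * m') * A * θ ^ 2 * θ ^ (m' - 4)) := by
    intro m' hm'
    have hcongr : ∑ m'' ∈ range (Fintype.card (GridLeg (GridPoint L (2 * (2 * M)))) / 2 + 1), (if m' ≤ m'' then ((2 * m'').choose (2 * m') : ℝ) * γ ^ (2 * m'' - 2 * m') * NR m'' else 0) =
        ∑ m'' ∈ range (Fintype.card (GridLeg (GridPoint L (2 * (2 * M)))) / 2 + 1),
          (if m' ≤ m'' then ((2 * m'').choose (2 * m') : ℝ) * γ ^ (2 * m'' - 2 * m') * (ρ⁻¹ ^ (2 * m'') * A * θ ^ 2 * θ ^ (m'' - 4)) else 0) := by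
      refine sum_congr rfl fun m'' _ => ?_
      split_ifs with h
      · rw [hNR]; dsimp only; rw [hNT_zero m'' (by omega), add_zero]
      · rfl
    rw [hcongr]
    exact klso_inner_le _ hγ hθ0 hθ1.le (by positivity) hA0 hy hg hm'
  have hsum : ∑ m' ∈ range (Fintype.card (GridLeg (GridPoint L (2 * (2 * M)))) / 2 + 1), (if 2 < m' then ((2 * m').choose (2 * 2) : ℝ) * κD ^ (2 * m' - 2 * 2) *
        (∑ m'' ∈ range (Fintype.card (GridLeg (GridPoint L (2 * (2 * M)))) / 2 + 1), if m' ≤ m'' then ((2 * m'').choose (2 * m') : ℝ) * γ ^ (2 * m'' - 2 * m') * NR m'' else 0) else 0) ≤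
      4 * (64 * κD ^ 2 * (2 * ρ⁻¹) ^ 6 * (7 * (A * θ ^ 2))) := by
    have hle : ∑ m' ∈ range (Fintype.card (GridLeg (GridPoint L (2 * (2 * M)))) / 2 + 1), (if 2 < m' then ((2 * m').choose (2 * 2) : ℝ) * κD ^ (2 * m' - 2 * 2) *
          (∑ m'' ∈ range (Fintype.card (GridLeg (GridPoint L (2 * (2 * M)))) / 2 + 1), if m' ≤ m'' then ((2 * m'').choose (2 * m') : ℝ) * γ ^ (2 * m'' - 2 * m') * NR m'' else 0) else 0) ≤
        ∑ m' ∈ range (Fintype.card (GridLeg (GridPoint L (2 * (2 * M)))) / 2 + 1), (if 2 < m' then ((2 * m').choose (2 * 2) : ℝ) * κD ^ (2 * m' - 2 * 2) *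
          ((2 * ρ⁻¹) ^ (2 * m') * (7 * (A * θ ^ 2)) * θ ^ (m' - 4)) else 0) := by
      refine sum_le_sum fun m' _ => ?_
      split_ifs with hm
      · refine mul_le_mul_of_nonneg_left ((hinner m' hm).trans (le_of_eq (by ring))) (by positivity)
      · exact le_rfl
    exact hle.trans (klso_outer_le _ hκD hθ0 (by positivity) (by positivity) hyD hu)
  -- (5) values
  rw [card_gridLeg_gridPoint, show ((Nat.factorial (2 * 2) : ℕ) : ℝ) = 24 by norm_num [Nat.factorial]]
  rw [card_gridLeg_gridPoint] at hsum
  calc (24 : ℝ) / (β * (L : ℝ) ^ 2) * (((4 * (2 * (2 * M)) * L ^ 2 : ℕ) : ℝ) *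
        ∑ m' ∈ range (((4 * (2 * (2 * M)) * L ^ 2 : ℕ)) / 2 + 1), (if 2 < m' then ((2 * m').choose (2 * 2) : ℝ) * κD ^ (2 * m' - 2 * 2) *
          (∑ m'' ∈ range (((4 * (2 * (2 * M)) * L ^ 2 : ℕ)) / 2 + 1), if m' ≤ m'' then ((2 * m'').choose (2 * m') : ℝ) * γ ^ (2 * m'' - 2 * m') * NR m'' else 0) else 0))
      ≤ (24 : ℝ) / (β * (L : ℝ) ^ 2) * (((4 * (2 * (2 * M)) * L ^ 2 : ℕ) : ℝ) * (4 * (64 * κD ^ 2 * (2 * ρ⁻¹) ^ 6 * (7 * (A * θ ^ 2))))) :=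
        mul_le_mul_of_nonneg_left (mul_le_mul_of_nonneg_left hsum (by positivity)) (by positivity)
    _ = 96 * (((2 * (2 * M)) : ℕ) : ℝ) / β * (1792 * κD ^ 2 * (2 * ρ⁻¹) ^ 6 * (A * θ ^ 2)) := by
        push_cast
        field_simp
        ring

end Step

end Summit.HubbardSuperconductivity.HubbardSuperconductivity.Theorems.KLRegimeSplit

end
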